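import Mathlib.Geometry.Manifold.PartitionOfUnity
import Mathlib.Geometry.Manifold.SmoothEmbedding
import Literature.Geometry.Lorentzian.Hypersurface
import Literature.Geometry.Lorentzian.Basic
import HarnessLib

/-!
# Extension of a compactly supported field along an embedded surface to an ambient vector field

For the stability of area-minimising surfaces (Schoen–Yau 1979, (2.13); `StabilityOfMinimizers.lean`)
one deforms an embedded surface `F₀ : S → X` in a Riemannian `3`-manifold by the flow of an ambient
vector field whose restriction to the surface is a prescribed compactly supported field `W`
along `F₀` (there `W = f ν`). This file proves the extension lemma:

* `exists_ambient_extension` — for a smooth embedding `F₀ : S → X` of a surface into a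
  `3`-manifold (Hausdorff, σ-compact, locally compact), a field `W` along `F₀` with smooth lift
  to `TX` vanishing off a compact `K ⊆ S`, there is a smooth, compactly supported vector field `Z`
  on `X` with `Z (F₀ y) = W y` for all `y ∈ S`.

Proof (Lee 2013, Lemma 8.6 / Prop. 8.11 pattern, "extension lemma for vector fields on
submanifolds"): Mathlib's `exists_contMDiffSection_forall_mem_convex_of_local` glues local sections
with values in the convex sets `t x = {v | v = W y whenever F₀ y = x, and v = 0 off a compact
neighbourhood of F₀(K)}` by a smooth partition of unity; local sections exist near points of
`F₀(K)` by the immersion charts of `F₀` (Mathlib's `Manifold.IsImmersionAt`: `F₀` reads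
`u ↦ L(u, 0)`, so `x ↦ φ⁻¹(pr₁ L⁻¹ ψ(x))` is a smooth local left inverse `prj` of `F₀`, and
`x ↦ W(prj x)` read in a trivialisation of `TX` is a smooth local section), the embedding property
making `prj ∘ F₀ = id` on the whole preimage of a small ambient neighbourhood, and by the zero
section away from `F₀(K)`.

Everything is proved; no definitions, no named facts.

## References

* J. M. Lee, *Introduction to Smooth Manifolds*, 2nd ed., GTM 218 (2013), Lemma 8.6 and
  Prop. 8.11 (extension of vector fields), Thm. 5.8 (slice charts). [LeeSmoothManifolds2013]
* R. Schoen, S.-T. Yau, Comm. Math. Phys. 65 (1979) 45–76, §2, (2.13). [SchoenYauPMT1979]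
-/

noncomputable section

open Bundle Set Manifold TopologicalSpace Filter Function
open scoped ContDiff Topology Manifold

namespace Literature.Geometry.Lorentzian

variable {X : Type*} [TopologicalSpace X] [ChartedSpace E3 X] [IsManifold (𝓡 3) ∞ X]
  {S : Type*} [TopologicalSpace S] [ChartedSpace (EuclideanSpace ℝ (Fin 2)) S]

/-- **Local left inverse and local extension at a point of an immersed surface.** For an
immersion `F₀` at `y₀` (Mathlib's chart description `u ↦ L(u, 0)`) and a field `W` along `F₀` with
smooth lift, there are an open `V ∋ y₀` in `S`, an open `O ∋ F₀ y₀` in `X` and a local section `s`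
of `TX`, smooth on `O`, with `s (F₀ y) = W y` for every `y ∈ V` with `F₀ y ∈ O`.
[cite: LeeSmoothManifolds2013, Lemma 8.6] -/
theorem exists_local_extension_of_isImmersionAt {F₀ : S → X} {y₀ : S}
    (hI : IsImmersionAt (𝓡 2) (𝓡 3) ∞ F₀ y₀)
    {W : Π y : S, TangentSpace (𝓡 3) (F₀ y)}
    (hW : ContMDiff (𝓡 2) (𝓡 3).tangent ∞
      (fun y ↦ (TotalSpace.mk' E3 (F₀ y) (W y) : TangentBundle (𝓡 3) X))) :
    ∃ (V : Set S) (O : Set X) (s : Π x : X, TangentSpace (𝓡 3) x),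
      IsOpen V ∧ y₀ ∈ V ∧ IsOpen O ∧ F₀ y₀ ∈ O ∧
      ContMDiffOn (𝓡 3) (𝓡 3).tangent ∞
        (fun x ↦ (TotalSpace.mk' E3 x (s x) : TangentBundle (𝓡 3) X)) O ∧
      ∀ y ∈ V, F₀ y ∈ O → s (F₀ y) = W y := by
  set h := hI.isImmersionAtOfComplement_complement with hh
  set φe := h.domChart.extend (𝓡 2) with hφe
  set ψe := h.codChart.extend (𝓡 3) with hψe
  set L := h.equiv with hL
  have hy₀ : y₀ ∈ h.domChart.source := h.mem_domChart_source
  have hx₀ : F₀ y₀ ∈ h.codChart.source := h.mem_codChart_source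
  have hwr := h.writtenInCharts
  -- `ψ(F₀ y) = L(φ y, 0)` on the domain chart
  have hchart : ∀ y ∈ h.domChart.source, ψe (F₀ y) = L (φe y, 0) := by
    intro y hy
    have hyt : φe y ∈ φe.target := φe.map_source (by rwa [hφe, OpenPartialHomeomorph.extend_source])
    have h1 := hwr hyt
    simp only [Function.comp_apply] at h1
    rwa [hφe, OpenPartialHomeomorph.extend_left_inv _ hy] at h1
  -- the local left inverse `prj x = φ⁻¹ (pr₁ (L⁻¹ (ψ x)))`
  set prj : X → S := fun x ↦ φe.symm (L.symm (ψe x)).1 with hprj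
  have hprjF : ∀ y ∈ h.domChart.source, prj (F₀ y) = y := by
    intro y hy
    simp only [hprj, hchart y hy, ContinuousLinearEquiv.symm_apply_apply]
    exact OpenPartialHomeomorph.extend_left_inv _ hy
  -- the open set where `prj` is defined and smooth
  set O₁ : Set X := h.codChart.source ∩ (fun x ↦ (L.symm (ψe x)).1) ⁻¹' φe.target with hO₁
  have hψc : ContinuousOn ψe h.codChart.source := by
    rw [hψe, ← OpenPartialHomeomorph.extend_source (I := 𝓡 3)]
    exact OpenPartialHomeomorph.continuousOn_extend _
  have hO₁o : IsOpen O₁ := by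
    have hc : ContinuousOn (fun x ↦ (L.symm (ψe x)).1) h.codChart.source :=
      (continuous_fst.comp L.symm.continuous).comp_continuousOn hψc
    have ht : IsOpen φe.target := by
      rw [hφe]; exact OpenPartialHomeomorph.isOpen_extend_target _
    exact hc.isOpen_inter_preimage h.codChart.open_source ht
  have hx₀O₁ : F₀ y₀ ∈ O₁ := by
    refine ⟨hx₀, ?_⟩
    show (L.symm (ψe (F₀ y₀))).1 ∈ φe.target
    rw [hchart y₀ hy₀, ContinuousLinearEquiv.symm_apply_apply]
    exact φe.map_source (by rwa [hφe, OpenPartialHomeomorph.extend_source])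
  have hprjs : ContMDiffOn (𝓡 3) (𝓡 2) ∞ prj O₁ := by
    have h1 : ContMDiffOn (𝓡 3) 𝓘(ℝ, E3) ∞ ψe h.codChart.source := by
      rw [hψe, ← OpenPartialHomeomorph.extend_source (I := 𝓡 3)]
      intro x hx
      rw [OpenPartialHomeomorph.extend_source] at hx
      exact (h.codChart.contMDiffAt_extend h.codChart_mem_maximalAtlas hx).contMDiffWithinAt
    have h2 : ContMDiffOn (𝓡 3) 𝓘(ℝ, EuclideanSpace ℝ (Fin 2)) ∞ (fun x ↦ (L.symm (ψe x)).1)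
        h.codChart.source :=
      (contDiff_fst.comp L.symm.contDiff).contMDiff.comp_contMDiffOn h1
    have h3 : ContMDiffOn 𝓘(ℝ, EuclideanSpace ℝ (Fin 2)) (𝓡 2) ∞ φe.symm φe.target := by
      have := contMDiffOn_extend_symm (I := 𝓡 2) h.domChart_mem_maximalAtlas
      rw [hφe, OpenPartialHomeomorph.extend_target']
      exact this
    exact h3.comp (h2.mono inter_subset_left) fun x hx ↦ hx.2
  -- the trivialisation of `TX` at `F₀ y₀` and the local section
  set e := trivializationAt E3 (TangentSpace (𝓡 3) : X → Type _) (F₀ y₀) with he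
  set c : X → E3 := fun x ↦ (e (TotalSpace.mk' E3 (F₀ (prj x)) (W (prj x)) : TangentBundle (𝓡 3) X)).2
    with hc
  set s : Π x : X, TangentSpace (𝓡 3) x := fun x ↦ e.symm x (c x) with hs
  set O : Set X := O₁ ∩ e.baseSet ∩ prj ⁻¹' (h.domChart.source ∩ F₀ ⁻¹' e.baseSet) with hO
  have hprjc : ContinuousOn prj O₁ := hprjs.continuousOn
  have hF₀c : ContinuousAt F₀ y₀ := h.continuousAt
  have hOo : IsOpen O := by
    have hpre : IsOpen (h.domChart.source ∩ F₀ ⁻¹' e.baseSet) := by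
      refine h.continuousOn.isOpen_inter_preimage h.domChart.open_source e.open_baseSet
    have h1 : IsOpen (O₁ ∩ prj ⁻¹' (h.domChart.source ∩ F₀ ⁻¹' e.baseSet)) :=
      hprjc.isOpen_inter_preimage hO₁o hpre
    have : O = (O₁ ∩ prj ⁻¹' (h.domChart.source ∩ F₀ ⁻¹' e.baseSet)) ∩ e.baseSet := by
      rw [hO]; ext x; simp only [mem_inter_iff, mem_preimage]; tauto
    rw [this]
    exact h1.inter e.open_baseSet
  have hbase₀ : F₀ y₀ ∈ e.baseSet := FiberBundle.mem_baseSet_trivializationAt' (F₀ y₀)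
  have hx₀O : F₀ y₀ ∈ O := by
    refine ⟨⟨hx₀O₁, hbase₀⟩, ?_⟩
    show prj (F₀ y₀) ∈ h.domChart.source ∩ F₀ ⁻¹' e.baseSet
    rw [hprjF y₀ hy₀]
    exact ⟨hy₀, hbase₀⟩
  refine ⟨h.domChart.source, O, s, h.domChart.open_source, hy₀, hOo, hx₀O, ?_, ?_⟩
  · -- smoothness of `s` on `O`
    intro x hx
    have hxb : x ∈ e.baseSet := hx.1.2
    have hprjx : prj x ∈ h.domChart.source ∧ F₀ (prj x) ∈ e.baseSet := hx.2
    -- `c` is smooth at `x` within `O`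
    have hlift : ContMDiffWithinAt (𝓡 3) (𝓡 3).tangent ∞
        (fun x' ↦ (TotalSpace.mk' E3 (F₀ (prj x')) (W (prj x')) : TangentBundle (𝓡 3) X)) O x :=
      ((hW (prj x)).comp_contMDiffWithinAt x ((hprjs x hx.1.1).mono (fun z hz ↦ hz.1.1)))
    have hsrc₁ : (TotalSpace.mk' E3 (F₀ (prj x)) (W (prj x)) : TangentBundle (𝓡 3) X) ∈ e.source := by
      rw [e.mem_source]; exact hprjx.2
    have hcs : ContMDiffWithinAt (𝓡 3) 𝓘(ℝ, E3) ∞ c O x :=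
      ((e.contMDiffWithinAt_iff (f := fun x' ↦ (TotalSpace.mk' E3 (F₀ (prj x')) (W (prj x')) :
        TangentBundle (𝓡 3) X)) hsrc₁).1 hlift).2
    have hsrc₂ : (TotalSpace.mk' E3 x (s x) : TangentBundle (𝓡 3) X) ∈ e.source := by
      rw [e.mem_source]; exact hxb
    refine ((e.contMDiffWithinAt_iff (f := fun x' ↦ (TotalSpace.mk' E3 x' (s x') :
      TangentBundle (𝓡 3) X)) hsrc₂).2 ⟨contMDiffWithinAt_id, ?_⟩)
    refine hcs.congr (fun x' hx' ↦ ?_) ?_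
    · show (e (TotalSpace.mk' E3 x' (e.symm x' (c x')))).2 = c x'
      rw [e.apply_mk_symm hx'.1.2]
    · show (e (TotalSpace.mk' E3 x (e.symm x (c x)))).2 = c x
      rw [e.apply_mk_symm hxb]
  · intro y hy hyO
    have hprjy : prj (F₀ y) = y := hprjF y hy
    have hyb : F₀ y ∈ e.baseSet := hyO.1.2
    have key : ∀ z : S, y = z →
        e.symm (F₀ y) (e (TotalSpace.mk' E3 (F₀ z) (W z) : TangentBundle (𝓡 3) X)).2 = W y := by
      rintro z rfl; exact e.symm_apply_apply_mk hyb (W y)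
    exact key _ hprjy.symm

/-- **Extension of a compactly supported field along an embedded surface** (Lee 2013, Lemma 8.6 /
Prop. 8.11, extension lemma for vector fields). For a smooth embedding `F₀ : S → X` of a surface
into a Hausdorff, σ-compact, locally compact `3`-manifold, a field `W` along `F₀` with smooth lift to
`TX` which vanishes off a compact `K ⊆ S`, there is a smooth vector field `Z` on `X`, vanishing off
a compact set, with `Z (F₀ y) = W y` for every `y ∈ S`. Proof: Mathlib's
`exists_contMDiffSection_forall_mem_convex_of_local` (smooth partition of unity) applied to the
convex constraint sets `t x = {v | v = W y whenever F₀ y = x} ∩ {v | v = 0 unless x ∈ int C}`,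
`C` a compact neighbourhood of `F₀(K)`; local sections near `F₀(K)` from
`exists_local_extension_of_isImmersionAt` and the embedding property (the local left inverse is a
left inverse on the whole preimage of a small ambient open set), the zero section elsewhere.
[cite: LeeSmoothManifolds2013, Lemma 8.6] -/
theorem exists_ambient_extension [T2Space X] [SigmaCompactSpace X] [LocallyCompactSpace X]
    {F₀ : S → X} (hemb : IsSmoothEmbedding (𝓡 2) (𝓡 3) ∞ F₀)
    {W : Π y : S, TangentSpace (𝓡 3) (F₀ y)}
    (hW : ContMDiff (𝓡 2) (𝓡 3).tangent ∞
      (fun y ↦ (TotalSpace.mk' E3 (F₀ y) (W y) : TangentBundle (𝓡 3) X)))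
    {K : Set S} (hK : IsCompact K) (hWK : ∀ y, y ∉ K → W y = 0) :
    ∃ Z : Π x : X, TangentSpace (𝓡 3) x,
      ContMDiff (𝓡 3) (𝓡 3).tangent ∞
        (fun x ↦ (TotalSpace.mk' E3 x (Z x) : TangentBundle (𝓡 3) X)) ∧
      (∃ C : Set X, IsCompact C ∧ ∀ x, x ∉ C → Z x = 0) ∧
      ∀ y, Z (F₀ y) = W y := by
  have hcont : Continuous F₀ := hemb.isEmbedding.continuous
  have hA : IsCompact (F₀ '' K) := hK.image hcont
  obtain ⟨C, hC, hAC⟩ := exists_compact_superset hA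
  -- the convex constraint sets
  set t : Π x : X, Set (TangentSpace (𝓡 3) x) := fun x ↦
    {v | (∀ y, F₀ y = x → (show E3 from v) = (show E3 from W y)) ∧ (x ∉ interior C → v = 0)}
    with ht
  have ht_conv : ∀ x, Convex ℝ (t x) := by
    intro x v hv w hw a b _ _ hab
    refine ⟨fun y hy ↦ ?_, fun hx ↦ ?_⟩
    · have h1 : (show E3 from v) = (show E3 from W y) := hv.1 y hy
      have h2 : (show E3 from w) = (show E3 from W y) := hw.1 y hy
      show a • (show E3 from v) + b • (show E3 from w) = (show E3 from W y)
      rw [h1, h2, ← add_smul, hab, one_smul]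
    · show a • v + b • w = 0
      rw [hv.2 hx, hw.2 hx, smul_zero, smul_zero, add_zero]
  -- local sections
  have Hloc : ∀ x₀ : X, ∃ U ∈ 𝓝 x₀, ∃ s : Π x : X, TangentSpace (𝓡 3) x,
      ContMDiffOn (𝓡 3) (𝓡 3).tangent ∞
        (fun x ↦ (TotalSpace.mk' E3 x (s x) : TangentBundle (𝓡 3) X)) U ∧
      ∀ x ∈ U, s x ∈ t x := by
    intro x₀
    by_cases hx₀ : x₀ ∈ F₀ '' K
    · obtain ⟨y₀, hy₀K, rfl⟩ := hx₀
      obtain ⟨V, O, s, hVo, hy₀V, hOo, hx₀O, hs, hsW⟩ :=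
        exists_local_extension_of_isImmersionAt (hemb.isImmersion.isImmersionAt y₀) hW
      obtain ⟨O', hO'o, hO'V⟩ := hemb.isEmbedding.isInducing.isOpen_iff.1 hVo
      refine ⟨O ∩ O' ∩ interior C, ?_, s, hs.mono fun x hx ↦ hx.1.1, fun x hx ↦ ⟨?_, fun h ↦ ?_⟩⟩
      · refine ((hOo.inter hO'o).inter isOpen_interior).mem_nhds ⟨⟨hx₀O, ?_⟩, hAC ⟨y₀, hy₀K, rfl⟩⟩
        show F₀ y₀ ∈ O'
        have : y₀ ∈ F₀ ⁻¹' O' := by rw [hO'V]; exact hy₀V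
        exact this
      · rintro y rfl
        have hyV : y ∈ V := by rw [← hO'V]; exact hx.1.2
        exact congrArg (fun v : TangentSpace (𝓡 3) (F₀ y) ↦ (show E3 from v)) (hsW y hyV hx.1.1)
      · exact absurd hx.2 h
    · refine ⟨(F₀ '' K)ᶜ, (hA.isClosed.isOpen_compl).mem_nhds hx₀, fun _ ↦ 0, ?_, fun x hx ↦ ⟨?_, fun _ ↦ rfl⟩⟩
      · exact (contMDiff_zeroSection (𝕜 := ℝ) (F := E3)
          (E := (TangentSpace (𝓡 3) : X → Type _))).contMDiffOn
      · rintro y rfl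
        have hyK : y ∉ K := fun h ↦ hx ⟨y, h, rfl⟩
        show (show E3 from (0 : TangentSpace (𝓡 3) (F₀ y))) = (show E3 from W y)
        rw [hWK y hyK]
  obtain ⟨Z, hZ⟩ := exists_contMDiffSection_forall_mem_convex_of_local (I := 𝓡 3) (n := ⊤)
    (F_fiber := E3) (TangentSpace (𝓡 3) : X → Type _) t ht_conv Hloc
  refine ⟨Z, Z.contMDiff, ⟨C, hC, fun x hx ↦ (hZ x).2 fun h ↦ hx (interior_subset h)⟩, fun y ↦ ?_⟩
  exact (hZ (F₀ y)).1 y rfl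

end Literature.Geometry.Lorentzian

end
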